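import Mathlib
import HarnessLib
import Summits.HubbardSuperconductivity.HubbardSuperconductivity.Theorems.KLProgrammeKLRegimeFlowReadResidueOsc
import Summits.HubbardSuperconductivity.HubbardSuperconductivity.Theorems.KLProgrammeKLRegimeTwoLegCurvatureConstsJetC2

/-!
# Route `KLProgramme`, crux K3 — gen-8 ENGINE-FLOW child (stmt-HubbardSuperconductivity-20437 `KLRegimeEngineV17F2`), stub (C)
# `stub_twoLeg_curvature`, v2 text: «(P)-STEP» — ONE LEMMA PER SCALE for the closer's PRIVATE two-conjunct induction
# (jets at a private table `(cc, cc′)` ∧ mean-free value at a private constant `x₀`), from (A) + the three residue doors' OUTPUTS + three numeric fits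

Seat hubbard-kl-k3c3-p1 (g10; row «δμ-flow with klAngularMean constant piece»).  The registered conclusion of stub (C) v2 at scale `n` is
`TwoLegReadJetBound L M klC4aJetC2 (klC4aJetC′ P R) … K_n n ∧ TwoLegReadOscAt L M (klReadOscC P R) … K_n n`; its proof runs a PRIVATE induction over
the scales (the history records only the generous `TwoLegReadJetsF` table, and the (C1) recursion closes only at natural-size private tables —
memos C1-HIST-C4 §3d, C1-OSC-IH §2) on the two-conjunct hypothesis

  `IHpriv n := TwoLegReadJetBound L M cc cc′ β U μ K_n n ∧ TwoLegReadOscAt L M x₀ β U μ K_n n`   (`cc, cc′, x₀` private, `n`-free),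

weakened to the registered tables at the end (`TwoLegReadJetBound.mono`, `TwoLegReadOscAt.mono`).  This file is the per-scale step and the base in
ABSTRACT door currency — every hypothesis is the literal output of a landed door:
* (A) c4a-1: `TwoLegCurveJetBound L M cA cA′ … K_{n+1} (n+1)` (`twoLegCurveJetBound_succ_of_inputs`) and the structured value
  `|δ_{n+1}(K_{n+1})(θ) − τ_A| ≤ a·U²·4^{−2(n+1)}` («(A)-OSC», the (A) capstone's `hV₀` split);
* (B) `frameResponse_hB_of_symbolSizes` (…FlowReadResponseFit, `eB 0 = 0`), (C2) `transport_jets_flow_fit` (…FlowReadTransportFit, `eT = 0`),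
  (C1) `readResidueC1_hJ_table<d>_(osc)fit` / `…_of_readJet_readOsc_klEng_of_le` / AN-FIT (`eJ 0 = 0`) — each as its `(h·diff, h·)` pair with its tables;
* three numeric fits: `cA + eB + eT + eJ ≤ cc`, `cA′ + eB′ + eT′ + eJ′ ≤ cc′` (entrywise) and `a + (eB′ 0 + eT′ 0 + eJ′ 0) ≤ x₀/2`.

* §1 **`twoLegReadPriv_flow_succ`** — `IHpriv`-free statement of the step: the hypotheses above ⟹ both conjuncts at `(K_{n+1}, n+1)` for the private
  `(cc, cc′, x₀)` (`readResidue_flow_hP` + c4a-1's `twoLegReadJetBound_flow_succ` + `TwoLegReadJetBound.mono` for the jets; `readResidue_flow_osc_of_hP` +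
  `twoLegReadOscAt_succ_of_structured` for the mean-free value);
* §2 **`twoLegReadPriv_zero`** — the base at `K₀ = 0` from (A) at scale `0` (jets `TwoLegCurveJetBound … 0 0` + structured value) and two fits;
* §3 **`twoLegRead_registered_of_priv`** — the final weakening to `(klC4aJetC2, klC4aJetC′ P R)` and `klReadOscC P R` (`cc ≤ klC4aJetC2`, `cc′ ≤ klC4aJetC′`,
  `x₀ ≤ klReadOscC`).

Bookkeeping only; no definition (the private hypothesis is written as a conjunction); nothing here asserts any stub of 20437, K3 or superconductivity.
References: BGM 2006 §2.4 (2.36)–(2.42) [cite: BenfattoGiulianiMastropietro2006].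
-/

noncomputable section

namespace Summit.HubbardSuperconductivity.HubbardSuperconductivity.Theorems.KLRegimeSplit

set_option linter.dupNamespace false -- summit = problem name (single-conjunct summit), D-0017

open Real Literature.MathematicalPhysics.QuantumLattice Literature.Probability.LatticeModels
open Literature.MathematicalPhysics.QuantumLattice.FermiRG

section Model

variable {L M : ℕ} [NeZero L] [NeZero M]

/-! ## §1 The step `n → n + 1` -/

/-- **«(P)-STEP» — the private two-conjunct induction step of stub (C) v2, one call per scale.**  At the flow frames `K_n`, `K_{n+1}` under the volume
guard `4·klFlowDeg (n+1) ≤ L`: (A) the slice-increment jets at a table `(cA, cA′)` and its structured value (`τ_A`, budget `a`); the (B), (C2), (C1) doors'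
outputs in `readResidue_flow_hP`'s currency with tables whose un-primed `k = 0` entries vanish; and the three fits ⟹ the jets at the private table `(cc, cc′)`
and the mean-free value clause at the private constant `x₀`, both at `(K_{n+1}, n+1)`. -/
theorem twoLegReadPriv_flow_succ (β U μ : ℝ) {n : ℕ} (hL : 4 * klFlowDeg (n + 1) ≤ L)
    {cA cA' eB eB' eT eT' eJ eJ' cc cc' : ℕ → ℝ} {τA a x₀ : ℝ}
    -- (A): slice-increment jets and structured value at the new frame
    (hA : TwoLegCurveJetBound L M cA cA' β U μ (klFlowFrameU L M β U μ (n + 1)) (n + 1))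
    (hAval : ∀ θ : ℝ, |klTwoLegCurveProfile L M β U μ (klFlowFrameU L M β U μ (n + 1)) (n + 1) θ - τA| ≤
      a * U ^ 2 * (4 : ℝ) ^ (-2 * ((n + 1 : ℕ) : ℤ)))
    -- (B): frame response
    (hBdiff : ContDiff ℝ 4 fun θ : ℝ =>
      (symInterp L (fun k => klLocSelfEnergyRe L M β U μ (klFlowFrameU L M β U μ (n + 1)) n k -
            (klFlowFrameU L M β U μ (n + 1)).eval (latticeMomentum L k))).eval (klFermiPoint μ (klFlowFrameU L M β U μ (n + 1)) θ) -
        (symInterp L (fun k => klLocSelfEnergyRe L M β U μ (klFlowFrameU L M β U μ n) n k -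
            (klFlowFrameU L M β U μ n).eval (latticeMomentum L k))).eval (klFermiPoint μ (klFlowFrameU L M β U μ (n + 1)) θ))
    (hB : ∀ k ≤ 4, ∀ θ : ℝ, |iteratedDeriv k (fun θ : ℝ =>
      (symInterp L (fun k => klLocSelfEnergyRe L M β U μ (klFlowFrameU L M β U μ (n + 1)) n k -
            (klFlowFrameU L M β U μ (n + 1)).eval (latticeMomentum L k))).eval (klFermiPoint μ (klFlowFrameU L M β U μ (n + 1)) θ) -
        (symInterp L (fun k => klLocSelfEnergyRe L M β U μ (klFlowFrameU L M β U μ n) n k -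
            (klFlowFrameU L M β U μ n).eval (latticeMomentum L k))).eval (klFermiPoint μ (klFlowFrameU L M β U μ (n + 1)) θ)) θ| ≤
      curveJetBar eB eB' U k (n + 1))
    -- (C2): transport
    (hTdiff : ContDiff ℝ 4 fun θ : ℝ =>
      (symInterp L (klLocSelfEnergyRe L M β U μ (klFlowFrameU L M β U μ n) n)).eval (klFermiPoint μ (klFlowFrameU L M β U μ (n + 1)) θ) -
        klLocalPart L M β U μ (klFlowFrameU L M β U μ n) n θ)
    (hT : ∀ k ≤ 4, ∀ θ : ℝ, |iteratedDeriv k (fun θ : ℝ =>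
      (symInterp L (klLocSelfEnergyRe L M β U μ (klFlowFrameU L M β U μ n) n)).eval (klFermiPoint μ (klFlowFrameU L M β U μ (n + 1)) θ) -
        klLocalPart L M β U μ (klFlowFrameU L M β U μ n) n θ) θ| ≤ curveJetBar eT eT' U k (n + 1))
    -- (C1): Jackson remainder
    (hJdiff : ContDiff ℝ 4 fun θ : ℝ => klLocalPart L M β U μ (klFlowFrameU L M β U μ n) n θ -
      (klFlowPiece L M β U μ n).eval (klFermiPoint μ (klFlowFrameU L M β U μ (n + 1)) θ))
    (hJ : ∀ k ≤ 4, ∀ θ : ℝ, |iteratedDeriv k (fun θ : ℝ => klLocalPart L M β U μ (klFlowFrameU L M β U μ n) n θ -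
      (klFlowPiece L M β U μ n).eval (klFermiPoint μ (klFlowFrameU L M β U μ (n + 1)) θ)) θ| ≤ curveJetBar eJ eJ' U k (n + 1))
    -- pure `U²` currency at `k = 0`
    (heB0 : eB 0 = 0) (heT0 : eT 0 = 0) (heJ0 : eJ 0 = 0)
    -- the three fits
    (hfit : ∀ k, cA k + (eB k + eT k + eJ k) ≤ cc k) (hfit' : ∀ k, cA' k + (eB' k + eT' k + eJ' k) ≤ cc' k)
    (hfitO : a + (eB' 0 + eT' 0 + eJ' 0) ≤ x₀ / 2) :
    TwoLegReadJetBound L M cc cc' β U μ (klFlowFrameU L M β U μ (n + 1)) (n + 1) ∧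
      TwoLegReadOscAt L M x₀ β U μ (klFlowFrameU L M β U μ (n + 1)) (n + 1) := by
  -- (P) the residue's jets in the summed tables
  obtain ⟨hPdiff, hP⟩ := readResidue_flow_hP β U μ hL hBdiff hB hTdiff hT hJdiff hJ
  -- jets: (A) + (P), then the fit
  have hjets : TwoLegReadJetBound L M cc cc' β U μ (klFlowFrameU L M β U μ (n + 1)) (n + 1) :=
    TwoLegReadJetBound.mono hfit hfit' (C4a.twoLegReadJetBound_flow_succ hA hPdiff hP)
  refine ⟨hjets, ?_⟩
  -- mean-free value: (A) structured + the residue within `(eB′0 + eT′0 + eJ′0)·U²·4^{−2(n+1)}` of `0`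
  have he0 : (fun k => eB k + eT k + eJ k) 0 = 0 := by simp [heB0, heT0, heJ0]
  have hPosc := readResidue_flow_osc_of_hP β U μ hP he0
  exact twoLegReadOscAt_succ_of_structured hjets.1.continuous hAval hPosc hfitO

/-! ## §2 The base `n = 0` at the bare frame `K₀ = 0` -/

/-- **«(P)-BASE»**: at scale `0` (`K₀ = 0`, `ν₀(0) = δ₀(0)`) the (A) jets `TwoLegCurveJetBound L M cA cA′ … 0 0`, the structured value
`|δ₀(0)(θ) − τ| ≤ a·U²` and the fits `cA ≤ cc`, `cA′ ≤ cc′`, `a ≤ x₀/2` give both private conjuncts at `(K₀, 0)`. -/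
theorem twoLegReadPriv_zero {β U μ : ℝ} {cA cA' cc cc' : ℕ → ℝ} {τ a x₀ : ℝ}
    (hA : TwoLegCurveJetBound L M cA cA' β U μ 0 0)
    (hAval : ∀ θ : ℝ, |klTwoLegCurveProfile L M β U μ 0 0 θ - τ| ≤ a * U ^ 2)
    (hfit : ∀ k, cA k ≤ cc k) (hfit' : ∀ k, cA' k ≤ cc' k) (hfitO : a ≤ x₀ / 2) :
    TwoLegReadJetBound L M cc cc' β U μ (klFlowFrameU L M β U μ 0) 0 ∧ TwoLegReadOscAt L M x₀ β U μ (klFlowFrameU L M β U μ 0) 0 := by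
  have hjets : TwoLegReadJetBound L M cc cc' β U μ (klFlowFrameU L M β U μ 0) 0 := by
    rw [klFlowFrameU_zero]
    exact TwoLegReadJetBound.mono hfit hfit' (C4a.twoLegReadJetBound_zero_of_curveJetBound hA)
  refine ⟨hjets, twoLegReadOscAt_zero_of_structured ?_ hAval hfitO⟩
  have h := hjets.1.continuous
  rwa [klFlowFrameU_zero] at h

/-! ## §3 The final weakening to the registered tables -/

/-- **From the private conjuncts to the REGISTERED conclusion of stub (C) v2** at any scale: `cc ≤ klC4aJetC2`, `cc′ ≤ klC4aJetC′ P R` (entrywise) and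
`x₀ ≤ klReadOscC P R`. -/
theorem twoLegRead_registered_of_priv {P : SplitConsts} {R : RenConsts} {β U μ : ℝ} {cc cc' : ℕ → ℝ} {x₀ : ℝ} {n : ℕ}
    (hcc : ∀ k, cc k ≤ klC4aJetC2 k) (hcc' : ∀ k, cc' k ≤ klC4aJetC' P R k) (hx₀ : x₀ ≤ klReadOscC P R)
    (h : TwoLegReadJetBound L M cc cc' β U μ (klFlowFrameU L M β U μ n) n ∧ TwoLegReadOscAt L M x₀ β U μ (klFlowFrameU L M β U μ n) n) :
    TwoLegReadJetBound L M klC4aJetC2 (klC4aJetC' P R) β U μ (klFlowFrameU L M β U μ n) n ∧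
      TwoLegReadOscAt L M (klReadOscC P R) β U μ (klFlowFrameU L M β U μ n) n :=
  ⟨h.1.mono hcc hcc', h.2.mono hx₀⟩

end Model

end Summit.HubbardSuperconductivity.HubbardSuperconductivity.Theorems.KLRegimeSplit

end
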